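import Summits.QuantumAdvantage.AdviceFreeQNC0.OddPrimeStatements
import Mathlib.Algebra.CharP.Two
import Mathlib.RingTheory.RootsOfUnity.PrimitiveRoots
import Mathlib.NumberTheory.Cyclotomic.PrimitiveRoots
import Mathlib.NumberTheory.LegendreSymbol.AddCharacter
import Mathlib.Algebra.CharP.Algebra
import HarnessLib

/-!
# M19 (characteristic-2 linearisation), part 1: Lemma M, the linearisation identity, Theorem B3 stages 0–2

ORIGINAL SUMMARY (planner qa-qnc0-p2 g19):

Companion to `HOME/qa-qnc0-p2/ROUND-19.md` and `line19/Sketch19.lean`.  Everything here is sorry-free, axioms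
`propext / Classical.choice / Quot.sound`, imports only the tree's `OddPrimeStatements` (+ Mathlib).  Contents:

* §M  `subcubeTransversal : SubcubeTransversal`, `masterLemma : MasterLemma` (the post functional, any field),
      `linearisationIdentity : LinearisationIdentity` (`WIN = Σ_g y_g (η^ℓ + η^{2ℓ})` in characteristic 2),
      `counterExpansion : CounterExpansion` (`[x = 0] = Σ_j ξ^{jx}`, `p` odd) — the four typed lemmas of Sketch19 §3.
* §B3 `exists_charTwo_field_with_roots` (a field of characteristic 2 with primitive cube and `p`-th roots: the cyclotomic
      field of order `3p` over `ZMod 2`), `loss_ge_of_posts` (abstract post bound), `seg_expansion` (the product-character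
      expansion of a segment-counter strategy), `seg_hit` (the `3p`-post design `[μ_p·η² | μ_p·η | μ_p·η²]` hits every
      term), and **`segCounterLoss : SegCounterLoss p`** = THEOREM B3 of ROUND-19: for `p` odd, `3 ∤ p`, `n ≥ 3p`, every
      charge, every segment-counter strategy loses on at least `2^{n−3p}` inputs.
* §R19 `walkHardFSegCounterG : WalkHardFSegCounterG p` (Sketch18 §6 R19 with the F-R60-1 guard; `θ = 1 − 2^{−3p}`,
      `n₀ = 3p`) and `walkHardFSegCounter_of_prime` (every prime `p ≥ 5`, the summit range) — R19 CLOSED.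
* §FormExp `form_expansion` / `form_expansion'`: the product-character expansion of ANY strategy whose cuts read `K`
      affine forms `β_j + Σ_i u_i L_{j,i}` over `ZMod p` through arbitrary tables (letters in `μ_p·{η,η²}`, none `= 1`).
* §B  **`intervalLoss : IntervalLoss p`** = THEOREM B of ROUND-19 (cuts reading `K` INTERVAL counters mod `p`, any
      intervals, any combiners): `#LOSE ≥ 2^{n − 2p(2K+2)}` from `n = 2p(2K+2)` on (`interval_hit`: `2K+2` blocks of `2p`
      posts, pigeonhole on the `2K+1` breakpoints); `interval_theta` = the `θ < 1` form.  Junta bits = intervals of length 1.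
* §A  **`affineTestsLoss : AffineTestsLoss p`** = THEOREM A of ROUND-19 (cuts = arbitrary Boolean functions of `K`
      arbitrary affine forms mod `p`): `#LOSE ≥ 2^{n−k}`, `k = 2p⌈log₂(2(n+1)p^K)⌉` (`greedy_posts` + strict Bernoulli
      `two_mul_pow_lt_pow`); `no_exact_affine_win` = (E-lin)/(E⁺-lin) of ROUND-17 §4, now a theorem.
* §B′ **`stepFormLoss : StepFormLoss p`** = THEOREM B′ (ROUND-19 addendum C; the exact reach of the block design =
      BOUNDED ALTERNATION): cuts reading `K` forms whose coefficient sequences are step functions with `≤ B` steps each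
      (`IsStepFormStrategy p K B`) lose on `≥ 2^{n − 2p(KB+2)}` inputs; `stepForm_theta`; `isStepForm_of_isInterval` +
      `intervalLoss_of_stepFormLoss` recover Theorem B with the same constant (`B = 2`).

PLACEMENT (qn-lit g24, P2-19b): the representation step (work in a field of characteristic 2 containing `μ_{3p}`, counters
as `μ_p`-characters, XOR as addition) is Barrington–Straubing–Thérien 1990 §6 / Theorem 9 (proof p. 127) specialised, with
Smolensky's 1987 change of variables; what is not in print is Lemma M (the post functional) with the hitting designs, which
turn BST90's vanishing-density term count into an `n`-independent loss fraction.

The statement names `lossCount`, `IsSegCounterStrategy`, `SegCounterLoss`, `WalkHardFSegCounterG` are verbatim those of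
Sketch19 (which is not importable); a prover porting this file under `AdviceFreeQNC0/` can take it as is (ask P2-19a).

PROVENANCE / PORT (ask P2-19a): authored by the planner seat qa-qnc0-p2 g19 (`HOME/qa-qnc0-p2/line19/M19Proofs.lean`, 1542 lines,
farm rc 0 / 0 sorry / 0 warnings), ported by qn-prover-3 g12 as six files `M19Linearisation` → `M19SegmentCounter` →
`M19FormExpansion` → `M19IntervalLoss` → `M19AffineTests` → `M19StepForms`; everything is placed in the namespace
`Summit.QuantumAdvantage.AdviceFreeQNC0.M19` (so `M19.winCount` / `M19.lossCount` do not shadow the cell's `AffBells22.winCount`),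
28 one-line docstrings were added, nothing else changed.  Separation NOT moved.
-/

namespace Summit.QuantumAdvantage.AdviceFreeQNC0.M19

open Finset

/-- **Lemma M (the post functional)**: if every term of `f = Σ_t C_t Π_{i : u_i} ρ_t(i)` carries a forbidden letter `α_i ≠ 1` at some post `i ∈ P`, then every subcube `{v : v|_(Pᶜ) = u|_(Pᶜ)}` contains a point with `f v ≠ 1`. -/
def MasterLemma : Prop :=
  ∀ (F : Type) [Field F] (n : ℕ) (ι : Type) (T : Finset ι) (C : ι → F) (ρ : ι → Fin n → F)
    (P : Finset (Fin n)) (α : Fin n → F),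
    (∀ i ∈ P, α i ≠ 1) → (∀ t ∈ T, ∃ i ∈ P, ρ t i = α i) →
    ∀ f : (Fin n → Bool) → F, (∀ u, f u = ∑ t ∈ T, C t * ∏ i : Fin n, (if u i = true then ρ t i else 1)) →
      ∀ u : Fin n → Bool, ∃ v : Fin n → Bool, (∀ i, i ∉ P → v i = u i) ∧ f v ≠ 1

/-- A set meeting every subcube `{v : v|_(Pᶜ) = u|_(Pᶜ)}` has at least `2^{n − |P|}` elements. -/
def SubcubeTransversal : Prop :=
  ∀ (n : ℕ) (P : Finset (Fin n)) (S : Finset (Fin n → Bool)),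
    (∀ u : Fin n → Bool, ∃ v ∈ S, ∀ i, i ∉ P → v i = u i) → 2 ^ (n - P.card) ≤ S.card

/-! ## SubcubeTransversal -/

/-- `SubcubeTransversal` PROVED (project onto the coordinates off `P`). -/
theorem subcubeTransversal : SubcubeTransversal := by
  intro n P S hS
  classical
  -- restriction to the complement of `P`
  let r : (Fin n → Bool) → (↥(Pᶜ) → Bool) := fun v i => v i.1
  have hsurj : Set.SurjOn r (S : Set (Fin n → Bool)) (Set.univ : Set (↥(Pᶜ) → Bool)) := by
    intro w _
    -- extend `w` by `false` on `P`
    let u : Fin n → Bool := fun i => if h : i ∈ Pᶜ then w ⟨i, h⟩ else false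
    obtain ⟨v, hvS, hv⟩ := hS u
    refine ⟨v, hvS, ?_⟩
    funext i
    have hi : i.1 ∉ P := Finset.mem_compl.mp i.2
    show v i.1 = w i
    rw [hv i.1 hi]
    show (if h : i.1 ∈ Pᶜ then w ⟨i.1, h⟩ else false) = w i
    rw [dif_pos i.2]
  have hcard := Finset.card_le_card_of_surjOn r (s := S) (t := (univ : Finset (↥(Pᶜ) → Bool))) (by simpa using hsurj)
  have hc : (univ : Finset (↥(Pᶜ) → Bool)).card = 2 ^ (n - P.card) := by
    rw [Finset.card_univ, Fintype.card_fun, Fintype.card_bool, Fintype.card_coe, Finset.card_compl, Fintype.card_fin]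
  rw [hc] at hcard
  exact hcard

/-! ## MasterLemma -/

/-- the vertex of the `P`-subcube at `u` indexed by `s ⊆ P`. -/
def cubePt {n : ℕ} (u : Fin n → Bool) (P s : Finset (Fin n)) : Fin n → Bool :=
  fun i => if i ∈ P then decide (i ∈ s) else u i

/-- Off `P`, `cubePt u P s` agrees with `u`. -/
theorem cubePt_off {n : ℕ} (u : Fin n → Bool) (P s : Finset (Fin n)) (i : Fin n) (hi : i ∉ P) :
    cubePt u P s i = u i := by simp [cubePt, hi]

/-- On `P`, `cubePt u P s` is the indicator of `s`. -/
theorem cubePt_on {n : ℕ} (u : Fin n → Bool) (P s : Finset (Fin n)) (i : Fin n) (hi : i ∈ P) :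
    cubePt u P s i = decide (i ∈ s) := by simp [cubePt, hi]

/-- a product character evaluated at a subcube vertex splits into the `P`-part and the off-`P` part. -/
theorem char_cubePt {F : Type} [Field F] {n : ℕ} (u : Fin n → Bool) (P s : Finset (Fin n)) (hs : s ⊆ P)
    (ρ : Fin n → F) :
    (∏ i : Fin n, (if cubePt u P s i = true then ρ i else 1))
      = (∏ i ∈ s, ρ i) * ∏ i ∈ Pᶜ, (if u i = true then ρ i else 1) := by
  classical
  rw [← Finset.prod_mul_prod_compl P]
  congr 1
  · calc (∏ i ∈ P, (if cubePt u P s i = true then ρ i else 1))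
          = ∏ i ∈ P, (if i ∈ s then ρ i else 1) := by
            refine Finset.prod_congr rfl (fun i hi => ?_)
            rw [cubePt_on u P s i hi]
            simp
      _ = ∏ i ∈ s, ρ i := by rw [Finset.prod_ite_mem, Finset.inter_eq_right.mpr hs]
  · refine Finset.prod_congr rfl (fun i hi => ?_)
    rw [cubePt_off u P s i (Finset.mem_compl.mp hi)]

/-- `MasterLemma` PROVED. -/
theorem masterLemma : MasterLemma := by
  intro F _ n ι T C ρ P α hα hhit f hf u
  classical
  by_contra hcon
  push Not at hcon
  -- every vertex of the `P`-subcube at `u` is a win: f (cubePt u P s) = 1 for all s ⊆ P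
  have hall : ∀ s ∈ P.powerset, f (cubePt u P s) = 1 :=
    fun s _ => hcon _ (fun i hi => cubePt_off u P s i hi)
  -- the post functional
  let w : Finset (Fin n) → F := fun s => ∏ i ∈ P \ s, (-α i)
  -- (b) φ(1) ≠ 0
  have hone : ∑ s ∈ P.powerset, (∏ i ∈ s, (1 : F)) * w s = ∏ i ∈ P, (1 + -α i) := by
    rw [Finset.prod_add]
  have hone' : ∑ s ∈ P.powerset, w s = ∏ i ∈ P, (1 - α i) := by
    have : ∑ s ∈ P.powerset, w s = ∑ s ∈ P.powerset, (∏ i ∈ s, (1 : F)) * w s := by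
      refine Finset.sum_congr rfl (fun s _ => ?_); simp
    rw [this, hone]
    refine Finset.prod_congr rfl (fun i _ => ?_); ring
  have hne : ∏ i ∈ P, (1 - α i) ≠ 0 := by
    rw [Finset.prod_ne_zero_iff]
    intro i hi
    exact sub_ne_zero.mpr (fun h => hα i hi h.symm)
  -- (a) φ(χ_t) = 0 for every hit character
  have hchar : ∀ t ∈ T,
      ∑ s ∈ P.powerset, w s * ∏ i : Fin n, (if cubePt u P s i = true then ρ t i else 1) = 0 := by
    intro t ht
    have hrw : ∀ s ∈ P.powerset,
        w s * ∏ i : Fin n, (if cubePt u P s i = true then ρ t i else 1)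
          = (∏ i ∈ Pᶜ, (if u i = true then ρ t i else 1)) * ((∏ i ∈ s, ρ t i) * w s) := by
      intro s hs
      rw [char_cubePt u P s (Finset.mem_powerset.mp hs) (ρ t)]
      ring
    rw [Finset.sum_congr rfl hrw, ← Finset.mul_sum, ← Finset.prod_add]
    obtain ⟨i, hiP, hi⟩ := hhit t ht
    have hz : ∏ i ∈ P, (ρ t i + -α i) = 0 :=
      Finset.prod_eq_zero hiP (by rw [hi]; ring)
    rw [hz, mul_zero]
  -- (c) φ(f) two ways
  have hφf : ∑ s ∈ P.powerset, w s * f (cubePt u P s) = ∑ s ∈ P.powerset, w s := by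
    refine Finset.sum_congr rfl (fun s hs => ?_)
    rw [hall s hs, mul_one]
  have hφf0 : ∑ s ∈ P.powerset, w s * f (cubePt u P s) = 0 := by
    have : ∀ s ∈ P.powerset, w s * f (cubePt u P s)
        = ∑ t ∈ T, C t * (w s * ∏ i : Fin n, (if cubePt u P s i = true then ρ t i else 1)) := by
      intro s _
      rw [hf, Finset.mul_sum]
      refine Finset.sum_congr rfl (fun t _ => ?_); ring
    rw [Finset.sum_congr rfl this, Finset.sum_comm]
    refine Finset.sum_eq_zero (fun t ht => ?_)
    rw [← Finset.mul_sum, hchar t ht, mul_zero]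
  rw [hφf0] at hφf
  exact hne (hone'.symm.trans hφf.symm)

/-! ## LinearisationIdentity and CounterExpansion -/

/-- **Linearisation identity** (characteristic 2): `[WIN] = Σ_g y_g (η^{ℓ_g} + η^{2ℓ_g})`. -/
def LinearisationIdentity : Prop :=
  ∀ (F : Type) [Field F] [CharP F 2] (η : F), η ^ 3 = 1 → η ≠ 1 →
    ∀ (n c : ℕ) (y : Fin (n + 1) → (Fin n → Bool) → Bool) (u : Fin n → Bool),
      (if ringWinU c y u = true then (1 : F) else 0)
        = ∑ g : Fin (n + 1),
            (if y g u = true then η ^ (c + g.val + walkExp u g.val) + η ^ (2 * (c + g.val + walkExp u g.val)) else 0)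

/-- **Counter expansion**: `[x = 0] = Σ_j ξ^{jx}` for a primitive `p`-th root of unity `ξ` (`p` odd). -/
def CounterExpansion : Prop :=
  ∀ (F : Type) [Field F] [CharP F 2] (p : ℕ) [NeZero p], Odd p → ∀ ξ : F, IsPrimitiveRoot ξ p →
    ∀ x : ZMod p, (if x = 0 then (1 : F) else 0) = ∑ j : ZMod p, ξ ^ (j * x).val

/-- `[ℓ ≢ 0 (mod 3)] = η^ℓ + η^{2ℓ}` in characteristic 2. -/
theorem eta_pow_add_eta_pow_two_mul (F : Type) [Field F] [CharP F 2] (η : F) (h3 : η ^ 3 = 1) (h1 : η ≠ 1)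
    (ℓ : ℕ) : η ^ ℓ + η ^ (2 * ℓ) = if ℓ % 3 = 0 then 0 else 1 := by
  have hq : η ^ 2 + η + 1 = 0 := by
    have hfac : (η - 1) * (η ^ 2 + η + 1) = 0 := by
      have : (η - 1) * (η ^ 2 + η + 1) = η ^ 3 - 1 := by ring
      rw [this, h3, sub_self]
    rcases mul_eq_zero.mp hfac with h | h
    · exact absurd (sub_eq_zero.mp h) h1
    · exact h
  have h2z : (2 : F) = 0 := CharTwo.two_eq_zero
  have key : ∀ m : ℕ, η ^ m = η ^ (m % 3) := by
    intro m
    conv_lhs => rw [← Nat.div_add_mod m 3, pow_add, pow_mul, h3, one_pow, one_mul]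
  rw [key ℓ, key (2 * ℓ)]
  rcases (by omega : ℓ % 3 = 0 ∨ ℓ % 3 = 1 ∨ ℓ % 3 = 2) with h | h | h
  · have h' : (2 * ℓ) % 3 = 0 := by omega
    rw [h, h']; simp only [pow_zero, if_true]
    linear_combination h2z
  · have h' : (2 * ℓ) % 3 = 2 := by omega
    rw [h, h']; simp only [pow_one, one_ne_zero, if_false]
    linear_combination hq - h2z
  · have h' : (2 * ℓ) % 3 = 1 := by omega
    rw [h, h']; simp only [pow_one, OfNat.ofNat_ne_zero, if_false]
    linear_combination hq - h2z

/-- `LinearisationIdentity` PROVED. -/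
theorem linearisationIdentity : LinearisationIdentity := by
  intro F _ _ η h3 h1 n c y u
  classical
  -- rewrite each summand as an indicator
  have hsum : (∑ g : Fin (n + 1),
      (if y g u = true then η ^ (c + g.val + walkExp u g.val) + η ^ (2 * (c + g.val + walkExp u g.val)) else 0))
      = ∑ g : Fin (n + 1), (if (y g u = true ∧ (c + g.val + walkExp u g.val) % 3 ≠ 0) then (1 : F) else 0) := by
    refine Finset.sum_congr rfl (fun g _ => ?_)
    rw [eta_pow_add_eta_pow_two_mul F η h3 h1]
    by_cases hy : y g u = true
    · by_cases hm : (c + g.val + walkExp u g.val) % 3 = 0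
      · simp [hy, hm]
      · simp [hy, hm]
    · simp [hy]
  rw [hsum, Finset.sum_boole]
  -- both sides are the parity of the same count
  set S := (univ.filter fun g : Fin (n + 1) => y g u = true ∧ (c + g.val + walkExp u g.val) % 3 ≠ 0) with hS
  have hwin : ringWinU c y u = decide (S.card % 2 = 1) := rfl
  rw [hwin, CharP.cast_eq_mod F 2 S.card]
  rcases Nat.mod_two_eq_zero_or_one S.card with h0 | h1'
  · rw [h0]; simp
  · rw [h1']; simp

/-- `CounterExpansion` PROVED. -/
theorem counterExpansion : CounterExpansion := by
  intro F _ _ p _ hp ξ hξ x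
  classical
  have hprim := AddChar.zmodChar_primitive_of_primitive_root p hξ
  have hsum := AddChar.sum_mulShift (R := ZMod p) x hprim
  simp only [AddChar.zmodChar_apply, ZMod.card, Nat.cast_ite, Nat.cast_zero] at hsum
  rw [hsum]
  split_ifs with hx
  · rw [CharP.cast_eq_mod F 2 p, Nat.odd_iff.mp hp, Nat.cast_one]
  · rfl

end Summit.QuantumAdvantage.AdviceFreeQNC0.M19

/-! ## Theorem B3 (segment counters) — Stage 0–2: field, helpers, abstract post bound -/

namespace Summit.QuantumAdvantage.AdviceFreeQNC0.M19

open Finset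

/-- number of losing inputs of strategy `y` at charge `c` (as in Sketch19 §2). -/
def lossCount {n : ℕ} (c : ℕ) (y : Fin (n + 1) → (Fin n → Bool) → Bool) : ℕ :=
  (univ.filter fun u : Fin n → Bool => ringWinU c y u = false).card

/-- Segment-counter strategies: `y_g` depends on the input only through `W_{<g} mod p` and `W mod p`. -/
def IsSegCounterStrategy (p n : ℕ) (y : Fin (n + 1) → (Fin n → Bool) → Bool) : Prop :=
  ∀ g : Fin (n + 1), ∀ u v : Fin n → Bool,
    wtPrefix u g.val % p = wtPrefix v g.val % p → wtPrefix u n % p = wtPrefix v n % p → y g u = y g v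

/-- **Theorem B3**: segment-counter strategies lose on at least `2^{n−3p}` inputs (`p` odd, `3 ∤ p`, `n ≥ 3p`), every charge. -/
def SegCounterLoss (p : ℕ) : Prop :=
  Odd p → ¬ 3 ∣ p → ∀ (n c : ℕ) (y : Fin (n + 1) → (Fin n → Bool) → Bool),
    IsSegCounterStrategy p n y → 3 * p ≤ n → 2 ^ (n - 3 * p) ≤ lossCount c y

/-- Stage 0: a field of characteristic 2 with a primitive cube root and a primitive `p`-th root of unity. -/
theorem exists_charTwo_field_with_roots (p : ℕ) (hp : Odd p) :
    ∃ (F : Type) (_ : Field F) (_ : CharP F 2) (η ξ : F), IsPrimitiveRoot η 3 ∧ IsPrimitiveRoot ξ p := by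
  haveI : Fact (Nat.Prime 2) := ⟨Nat.prime_two⟩
  have hp0 : 0 < p := hp.pos
  haveI : NeZero (3 * p) := ⟨by omega⟩
  haveI hnz : NeZero ((3 * p : ℕ) : ZMod 2) := ⟨by
    rw [Ne, ZMod.natCast_eq_zero_iff_even, Nat.not_even_iff_odd]
    exact (by decide : Odd 3).mul hp⟩
  let L := CyclotomicField (3 * p) (ZMod 2)
  haveI : CharP L 2 := charP_of_injective_algebraMap (algebraMap (ZMod 2) L).injective 2
  refine ⟨L, inferInstance, inferInstance, (IsCyclotomicExtension.zeta (3 * p) (ZMod 2) L) ^ p,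
    (IsCyclotomicExtension.zeta (3 * p) (ZMod 2) L) ^ 3, ?_, ?_⟩
  · exact (IsCyclotomicExtension.zeta_spec (3 * p) (ZMod 2) L).pow (by omega) (by ring)
  · exact (IsCyclotomicExtension.zeta_spec (3 * p) (ZMod 2) L).pow (by omega) rfl

section Helpers
variable {F : Type} [Field F]

/-- Product of two Boolean-gated products. -/
theorem prod_boolIte_mul {n : ℕ} (u : Fin n → Bool) (a b : Fin n → F) :
    (∏ i, (if u i = true then a i else 1)) * (∏ i, (if u i = true then b i else 1))
      = ∏ i, (if u i = true then a i * b i else 1) := by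
  rw [← Finset.prod_mul_distrib]
  refine Finset.prod_congr rfl (fun i _ => ?_)
  cases u i <;> simp

/-- `x^{wt u}` as a Boolean-gated product. -/
theorem pow_wt_eq_prod {n : ℕ} (u : Fin n → Bool) (x : F) :
    x ^ wt u = ∏ i, (if u i = true then x else 1) := by
  unfold wt
  rw [← Finset.prod_const, Finset.prod_filter]

/-- `x^{wtPrefix u g}` as a Boolean-gated product. -/
theorem pow_wtPrefix_eq_prod {n : ℕ} (u : Fin n → Bool) (g : ℕ) (x : F) :
    x ^ wtPrefix u g = ∏ i, (if u i = true then (if i.val < g then x else 1) else 1) := by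
  unfold wtPrefix
  rw [← Finset.prod_const, Finset.prod_filter]
  refine Finset.prod_congr rfl (fun i _ => ?_)
  by_cases h1 : i.val < g <;> cases u i <;> simp [h1]

/-- `wtPrefix u n = wt u`. -/
theorem wtPrefix_eq_wt {n : ℕ} (u : Fin n → Bool) : wtPrefix u n = wt u := by
  unfold wtPrefix wt
  congr 1
  ext i
  simp

/-- `ψ (j * w) = (ψ j)^w` for an additive character and a natural number `w`. -/
theorem addChar_mul_natCast {R : Type} [CommRing R] (ψ : AddChar R F) (j : R) (w : ℕ) :
    ψ (j * (w : R)) = (ψ j) ^ w := by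
  induction w with
  | zero => simp
  | succ w ih => rw [Nat.cast_succ, mul_add, mul_one, AddChar.map_add_eq_mul, ih, pow_succ]

end Helpers

/-- Stage 2: the abstract post bound — a product-character expansion of the win indicator all of whose terms are hit
by posts on `P` forces `#LOSE ≥ 2^{n − |P|}`. -/
theorem loss_ge_of_posts {F : Type} [Field F] {n : ℕ} (c : ℕ) (y : Fin (n + 1) → (Fin n → Bool) → Bool)
    (ι : Type) (T : Finset ι) (C : ι → F) (ρ : ι → Fin n → F) (P : Finset (Fin n)) (α : Fin n → F)
    (hα : ∀ i ∈ P, α i ≠ 1) (hhit : ∀ t ∈ T, ∃ i ∈ P, ρ t i = α i)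
    (hf : ∀ u, (if ringWinU c y u = true then (1 : F) else 0)
      = ∑ t ∈ T, C t * ∏ i : Fin n, (if u i = true then ρ t i else 1)) :
    2 ^ (n - P.card) ≤ lossCount c y := by
  classical
  apply subcubeTransversal n P
  intro u
  obtain ⟨v, hv, hne⟩ := masterLemma F n ι T C ρ P α hα hhit _ hf u
  refine ⟨v, ?_, hv⟩
  rw [Finset.mem_filter]
  refine ⟨Finset.mem_univ _, ?_⟩
  cases h : ringWinU c y v
  · rfl
  · exact absurd (by rw [h]; simp) hne

end Summit.QuantumAdvantage.AdviceFreeQNC0.M19
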